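import Mathlib.Geometry.Manifold.VectorBundle.CovariantDerivative.Torsion
import Literature.Geometry.Lorentzian.LorentzianMetric
import Literature.Geometry.Lorentzian.LeviCivita
import HarnessLib

-- provenance: harness21/H21/H21/Prelude/Lorentz/Einstein.lean @ 06ba227 (interim HEAD d8f2665); M5 mechanical rewrite
/-!
# The Einstein equations and energy conditions (trunk G08 = T-LORENTZ, C5)

For a `C^n` pseudo-Riemannian metric `g` on the tangent bundle of a real manifold `M`
(`g : PseudoRiemannianMetric I n E (TangentSpace I : M → Type _)`, `1 ≤ n`) we define

* `g.IsRicciFlat`: the **Einstein vacuum equations** `Ric(g) = 0`;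
* `g.IsEinsteinVacuum Λ`: the vacuum equations with cosmological constant, `Ric(g) = Λ g`;
* `g.SatisfiesEinsteinEquations T Λ`: the full Einstein equations
  `G + Λ g = 8π T` (`G = Ric - (S/2) g`, units `G_Newton = c = 1`) for a field of continuous
  bilinear forms `T` (the stress–energy tensor);

and for a Lorentzian metric `g : LorentzianMetric I n M` (with time orientation `τ` where needed)

* `g.SatisfiesNullConvergence`, `g.SatisfiesTimelikeConvergence`: `Ric(v,v) ≥ 0` for null,
  resp. timelike, `v`;
* `g.SatisfiesDominantEnergyCondition τ T`, `g.SatisfiesWeakEnergyCondition T`,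
  `g.SatisfiesNullEnergyCondition T`: the pointwise energy conditions on `T`;
* `satisfiesNullConvergence_of_einstein_of_nullEnergy`: Einstein equations + null energy
  condition imply the null convergence condition.

## Sources

R. M. Wald, *General Relativity* (1984), (4.3.21) (Einstein's equation `G_{ab} = 8π T_{ab}`),
§9.2 (energy conditions), p. 219; S. W. Hawking, G. F. R. Ellis, *The large scale structure of
space-time* (1973), §3.4 ((3.14) with `Λ`), §4.3 (weak / dominant energy conditions, null and
timelike convergence conditions); B. O'Neill, *Semi-Riemannian geometry* (1983), Ch. 12,
Def. 12.3 ff. (Einstein equation, vacuum `Ric = 0`).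

## Mathlib

Mathlib (at the pin) has no Ricci curvature, Einstein tensor or energy condition
(`rg -i 'ricci|einstein.*equation|energy ?condition' Mathlib` finds nothing relevant); the
curvature tensors come from `H21/Prelude/Lorentz/LeviCivita.lean`. We use Mathlib's
`ContinuousLinearMap.toLinearMap₁₂` to view the CLM-valued stress–energy tensor as a
`LinearMap.BilinForm`.

## Design

* The stress–energy tensor is an unbundled field of continuous bilinear forms
  `T : Π x, TangentSpace I x →L[ℝ] TangentSpace I x →L[ℝ] ℝ`, exactly like the second
  fundamental form `k` of an initial data set (C12 of the outline); no smoothness or symmetry is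
  built in (statements add them as hypotheses when needed).
* All curvature-dependent notions assume `[FiniteDimensional ℝ E] [CompleteSpace E]
  [Fact (1 ≤ n)]` (inherited from `leviCivita`); for smooth (`n = ∞`) or analytic metrics the
  `Fact` instance is automatic. The energy conditions on `T` need none of these.
* The dominant energy condition is stated in the bilinear form
  `T(v, w) ≥ 0` for all future-directed causal `v, w`, which is equivalent to Hawking–Ellis'
  formulation (`T(W,W) ≥ 0` and `-T^a{}_b W^b` future-directed causal or zero for timelike
  future-directed `W`) and needs no musical isomorphism. It depends on `τ` only through the
  choice of one of the two timecones, and is invariant under `τ ↦ τ.reverse`.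
* The weak and null energy conditions and the convergence conditions do not depend on a time
  orientation (they are quadratic in `v`).
* **M5 migration note.** The curvature API of `LeviCivita` carries the standing hypothesis
  `[g.HasLeviCivita]`; it is a section variable here, so `IsRicciFlat`, `IsEinsteinVacuum`,
  `SatisfiesEinsteinEquations`, `SatisfiesNullConvergence`, `SatisfiesTimelikeConvergence` and
  their lemmas take `[g.HasLeviCivita]`. The two results proved in print but not here
  (`isRicciFlat_of_satisfiesEinsteinEquations_zero`,
  `SatisfiesWeakEnergyCondition.satisfiesNullEnergyCondition`) are named facts.
-/

noncomputable section

open Bundle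
open scoped Manifold ContDiff Topology

namespace Literature.Geometry.Lorentzian

variable {E : Type*} [NormedAddCommGroup E] [NormedSpace ℝ E] {H : Type*} [TopologicalSpace H]
  {I : ModelWithCorners ℝ E H} {M : Type*} [TopologicalSpace M] [ChartedSpace H M]
  [IsManifold I ∞ M] {n : ℕ∞ω}

namespace PseudoRiemannianMetric

variable [FiniteDimensional ℝ E] [CompleteSpace E] [Fact (1 ≤ n)]

variable (g : PseudoRiemannianMetric I n E (TangentSpace I : M → Type _)) [g.HasLeviCivita]

/-- **gr.S13** (Einstein vacuum equations `Ric(g) = 0`; O'Neill 1983 Ch. 12, Hawking–Ellis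
§4.3). The pseudo-Riemannian metric `g` is **Ricci-flat**, i.e. satisfies the **Einstein vacuum
equations** `Ric(g) = 0`: its Ricci tensor vanishes at every point. O'Neill 1983, Ch. 3, after
Lemma 3.52 ("If its Ricci tensor is identically zero, M is said to be Ricci flat") and Ch. 12,
12.3 ff., pp. 336–337 (vacuum = Ricci flat spacetime); Wald, *General Relativity*, (4.3.21)
with `T = 0` (equivalently `G = 0`, since `S = 0` follows by tracing). A parametrised
predicate: the metric `g` and its Levi-Civita hypothesis are explicit binders of the definition
(not section variables). [cite: ONeill1983, Ch. 3, after Lemma 3.52; Ch. 12, 12.3 ff.] -/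
def IsRicciFlat (g : PseudoRiemannianMetric I n E (TangentSpace I : M → Type _))
    [g.HasLeviCivita] : Prop :=
  ∀ x : M, g.ricci x = 0

/-- The pseudo-Riemannian metric `g` satisfies the **Einstein vacuum equations with cosmological
constant** `Λ`: `Ric(g) = Λ g` at every point (so `g` is an Einstein metric with Einstein
constant `Λ`; for `dim M = 4` this is `G + Λ' g = 0` with `Λ' = Λ`, by tracing).
Hawking–Ellis 1973, §3.4, (3.14) with `T = 0`; Wald, *General Relativity*, p. 99, (5.2.17) ff. [cite: HawkingEllis1973, §3.4  (3.14] -/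
def IsEinsteinVacuum (Λ : ℝ) : Prop :=
  ∀ x : M, g.ricci x = Λ • g.toBilinForm x

/-- The pseudo-Riemannian metric `g` satisfies the **Einstein equations** with stress–energy
tensor `T` (a field of continuous bilinear forms on `TM`) and cosmological constant `Λ`:
`G + Λ g = 8π T` at every point, where `G = Ric - (S/2) g` is the Einstein tensor
(`PseudoRiemannianMetric.einsteinTensor`); geometrised units `G_Newton = c = 1`.
Wald, *General Relativity*, (4.3.21); Hawking–Ellis 1973, §3.4, (3.14). [cite: HawkingEllis1973, §3.4  (3.14] -/
def SatisfiesEinsteinEquations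
    (T : Π x : M, TangentSpace I x →L[ℝ] TangentSpace I x →L[ℝ] ℝ) (Λ : ℝ) : Prop :=
  ∀ x : M, g.einsteinTensor x + Λ • g.toBilinForm x = (8 * Real.pi) • (T x).toLinearMap₁₂

omit [FiniteDimensional ℝ E] [CompleteSpace E] [Fact (1 ≤ n)] in
/-- Ricci-flat means Einstein vacuum with `Λ = 0`. O'Neill 1983, Ch. 12, Def. 12.3 ff. [cite: ONeill1983, Ch. 12  Def. 12.3 ff] -/
lemma isRicciFlat_iff_isEinsteinVacuum_zero : g.IsRicciFlat ↔ g.IsEinsteinVacuum 0 := by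
  simp [IsRicciFlat, IsEinsteinVacuum]

omit [CompleteSpace E] [Fact (1 ≤ n)] in
/-- A Ricci-flat metric has vanishing scalar curvature. O'Neill 1983, Ch. 3, Def. 3.53. [cite: ONeill1983, Ch. 3  Def. 3.53] -/
lemma IsRicciFlat.scalarCurvature_eq_zero {g : PseudoRiemannianMetric I n E
    (TangentSpace I : M → Type _)} [g.HasLeviCivita] (h : g.IsRicciFlat) (x : M) :
    g.scalarCurvature x = 0 := by
  simp [scalarCurvature, h x, trace]

omit [CompleteSpace E] [Fact (1 ≤ n)] in
/-- A Ricci-flat metric has vanishing Einstein tensor. Wald, *General Relativity*, (3.2.28). [folklore] -/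
lemma IsRicciFlat.einsteinTensor_eq_zero {g : PseudoRiemannianMetric I n E
    (TangentSpace I : M → Type _)} [g.HasLeviCivita] (h : g.IsRicciFlat) (x : M) :
    g.einsteinTensor x = 0 := by
  ext v w
  simp [einsteinTensor_apply, h x, h.scalarCurvature_eq_zero x]

omit [CompleteSpace E] [Fact (1 ≤ n)] in
/-- A Ricci-flat metric satisfies the Einstein equations with `T = 0` and `Λ = 0`.
Wald, *General Relativity*, (4.3.21). [folklore] -/
lemma IsRicciFlat.satisfiesEinsteinEquations_zero {g : PseudoRiemannianMetric I n E
    (TangentSpace I : M → Type _)} [g.HasLeviCivita] (h : g.IsRicciFlat) :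
    g.SatisfiesEinsteinEquations (fun _ ↦ 0) 0 := by
  intro x
  rw [h.einsteinTensor_eq_zero x, zero_smul, add_zero]
  ext v w
  simp

-- Binder repair (2026-08-16): the header instance deliberately shadows the section's, which a
-- `def` does not capture (it ranged too widely before); the overlapping-instances linter is moot.
set_option linter.overlappingInstances false in
/-- Conversely, the Einstein equations with `T = 0`, `Λ = 0` are equivalent to Ricci-flatness
(trace `G = 0` to get `(1 - d/2) S = 0`, hence `S = 0` when `d ≠ 2`, hence `Ric = 0`).
Wald, *General Relativity*, p. 73 (discussion after (4.3.21)); O'Neill 1983, Ch. 12, p. 336.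
Named fact (statement only; the metric `g` is an explicit argument). [cite: ONeill1983, Ch. 12, p. 336]
(Binder repair 2026-08-16: `[CompleteSpace E]` is written in the header so that it is a parameter
of the elaborated constant; as a section instance unused by the body it was silently dropped, so
the fact ranged over cases the printed theorem excludes.) -/
def isRicciFlat_of_satisfiesEinsteinEquations_zero [CompleteSpace E] : Prop :=
  Module.finrank ℝ E ≠ 2 → g.SatisfiesEinsteinEquations (fun _ ↦ 0) 0 → g.IsRicciFlat

end PseudoRiemannianMetric

namespace LorentzianMetric

variable (g : LorentzianMetric I n M)

/-! ### Energy conditions on a stress–energy tensor -/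

/-- The stress–energy tensor `T` satisfies the **dominant energy condition** w.r.t. the
time-oriented Lorentzian metric `(g, τ)`: `T(v, w) ≥ 0` for all future-directed causal vectors
`v, w` at every point. This is equivalent to Hawking–Ellis' formulation "`T(W,W) ≥ 0` and
`-T^a{}_b W^b` is future-directed causal or zero for every future-directed timelike `W`".
Hawking–Ellis 1973, §4.3, p. 91; Wald, *General Relativity*, §9.2, p. 219. [cite: HawkingEllis1973, §4.3  p. 91] -/
def SatisfiesDominantEnergyCondition (τ : TimeOrientation g)
    (T : Π x : M, TangentSpace I x →L[ℝ] TangentSpace I x →L[ℝ] ℝ) : Prop :=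
  ∀ (x : M) (v w : TangentSpace I x), τ.IsFutureDirected v → τ.IsFutureDirected w → 0 ≤ T x v w

/-- The stress–energy tensor `T` satisfies the **weak energy condition** w.r.t. `g`:
`T(v, v) ≥ 0` for every timelike vector `v`. Hawking–Ellis 1973, §4.3, p. 89;
Wald, *General Relativity*, §9.2, (9.2.1). [cite: HawkingEllis1973, §4.3  p. 89] -/
def SatisfiesWeakEnergyCondition
    (T : Π x : M, TangentSpace I x →L[ℝ] TangentSpace I x →L[ℝ] ℝ) : Prop :=
  ∀ (x : M) (v : TangentSpace I x), g.IsTimelike v → 0 ≤ T x v v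

/-- The stress–energy tensor `T` satisfies the **null energy condition** w.r.t. `g`:
`T(v, v) ≥ 0` for every null vector `v`. Wald, *General Relativity*, §9.2, p. 219;
Hawking–Ellis 1973, §4.3, p. 95 (via the Einstein equations this is the null convergence
condition). [cite: HawkingEllis1973, §4.3  p. 95 (via the Einstein equations] -/
def SatisfiesNullEnergyCondition
    (T : Π x : M, TangentSpace I x →L[ℝ] TangentSpace I x →L[ℝ] ℝ) : Prop :=
  ∀ (x : M) (v : TangentSpace I x), g.IsNull v → 0 ≤ T x v v

variable {g}

/-- The dominant energy condition is invariant under reversal of the time orientation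
(`T(-v, -w) = T(v, w)`). Hawking–Ellis 1973, §4.3. [cite: HawkingEllis1973, §4.3] -/
lemma SatisfiesDominantEnergyCondition.reverse {τ : TimeOrientation g}
    {T : Π x : M, TangentSpace I x →L[ℝ] TangentSpace I x →L[ℝ] ℝ}
    (h : g.SatisfiesDominantEnergyCondition τ T) :
    g.SatisfiesDominantEnergyCondition τ.reverse T := by
  intro x v w hv hw
  rw [TimeOrientation.isFutureDirected_reverse_iff, ← TimeOrientation.isFutureDirected_neg_iff]
    at hv hw
  simpa using h x (-v) (-w) hv hw

/-- The dominant energy condition implies the weak energy condition (every timelike vector is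
future- or past-directed, and `T(v,v) = T(-v,-v)`). Hawking–Ellis 1973, §4.3, p. 91. [cite: HawkingEllis1973, §4.3  p. 91] -/
lemma SatisfiesDominantEnergyCondition.satisfiesWeakEnergyCondition {τ : TimeOrientation g}
    {T : Π x : M, TangentSpace I x →L[ℝ] TangentSpace I x →L[ℝ] ℝ}
    (h : g.SatisfiesDominantEnergyCondition τ T) : g.SatisfiesWeakEnergyCondition T := by
  intro x v hv
  rcases τ.isFutureDirected_or_isPastDirected_of_isCausal hv.isCausal with hf | hp
  · exact h x v v hf hf
  · have hf : τ.IsFutureDirected (-v) := (τ.isFutureDirected_neg_iff v).2 hp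
    simpa using h x (-v) (-v) hf hf

variable (g) in
/-- The weak energy condition implies the null energy condition, provided `T` is continuous in
its arguments (automatic) — null vectors are limits of timelike ones. Hawking–Ellis 1973, §4.3,
p. 89 ("by continuity ... for every null vector"); Wald, *General Relativity*, §9.2. Named fact
(statement only; the Lorentzian metric `g` is an explicit argument, `T` is quantified). [cite: HawkingEllis1973, §4.3, p. 89] -/
def SatisfiesWeakEnergyCondition.satisfiesNullEnergyCondition : Prop :=
  ∀ {T : Π x : M, TangentSpace I x →L[ℝ] TangentSpace I x →L[ℝ] ℝ},
    g.SatisfiesWeakEnergyCondition T → g.SatisfiesNullEnergyCondition T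

end LorentzianMetric

/-! ### Convergence conditions -/

namespace LorentzianMetric

variable [FiniteDimensional ℝ E] [CompleteSpace E] [Fact (1 ≤ n)] (g : LorentzianMetric I n M)
  [g.HasLeviCivita]

/-- The Lorentzian metric `g` satisfies the **null convergence condition**: `Ric(v, v) ≥ 0` for
every null vector `v`. This is a DEFINITION — Hawking–Ellis 1973, §4.3, p. 95: "We shall call
this the *null convergence condition*" (a standing hypothesis of the singularity theorems) — not
an assertion about every metric: it fails e.g. for a flat FLRW metric `-dt² + a(t)² δ` with
`Ḣ > 0`, where `Ric(k, k) = -(d - 2) Ḣ (k⁰)²` for null `k`. Under the Einstein equations it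
follows from the null (a fortiori the weak) energy condition for any `Λ`
(`satisfiesNullConvergence_of_einstein_of_nullEnergy`; Hawking–Ellis, loc. cit.). A parametrised
predicate: the metric `g` and `[g.HasLeviCivita]` are explicit binders of the definition.
[cite: HawkingEllis1973, §4.3, p. 95] -/
def SatisfiesNullConvergence (g : LorentzianMetric I n M) [g.HasLeviCivita] : Prop :=
  ∀ (x : M) (v : TangentSpace I x), g.IsNull v → 0 ≤ g.ricci x v v

/-- The Lorentzian metric `g` satisfies the **timelike convergence condition**: `Ric(v, v) ≥ 0`
for every timelike vector `v` — again a DEFINITION (Hawking–Ellis 1973, §4.3, p. 95: "We shall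
call this the *timelike convergence condition*"), a parametrised predicate with the metric `g`
and `[g.HasLeviCivita]` as explicit binders. [cite: HawkingEllis1973, §4.3, p. 95] -/
def SatisfiesTimelikeConvergence (g : LorentzianMetric I n M) [g.HasLeviCivita] : Prop :=
  ∀ (x : M) (v : TangentSpace I x), g.IsTimelike v → 0 ≤ g.ricci x v v

variable {g}

omit [CompleteSpace E] [Fact (1 ≤ n)] in
/-- **Einstein equations + null energy condition ⇒ null convergence condition.** If `g` satisfies
the Einstein equations `G + Λ g = 8π T` and `T(v,v) ≥ 0` for null `v`, then `Ric(v,v) ≥ 0` for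
null `v` (the terms `(S/2) g(v,v)` and `Λ g(v,v)` vanish on null vectors), for any value of `Λ`.
Hawking–Ellis 1973, §4.3, p. 95; Wald, *General Relativity*, §9.2, p. 219. [cite: HawkingEllis1973, §4.3  p. 95] -/
theorem satisfiesNullConvergence_of_einstein_of_nullEnergy
    {T : Π x : M, TangentSpace I x →L[ℝ] TangentSpace I x →L[ℝ] ℝ} {Λ : ℝ}
    (hE : g.toPseudoRiemannianMetric.SatisfiesEinsteinEquations T Λ)
    (hT : g.SatisfiesNullEnergyCondition T) : g.SatisfiesNullConvergence := by
  intro x v hv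
  have h := congrArg (fun B : LinearMap.BilinForm ℝ (TangentSpace I x) ↦ B v v) (hE x)
  simp only [LinearMap.add_apply, LinearMap.smul_apply,
    PseudoRiemannianMetric.einsteinTensor_apply, PseudoRiemannianMetric.toBilinForm_apply,
    ContinuousLinearMap.toLinearMap₁₂_apply, smul_eq_mul, hv.1, mul_zero, sub_zero,
    add_zero] at h
  have := hT x v hv
  change 0 ≤ g.toPseudoRiemannianMetric.ricci x v v
  rw [h]
  positivity

omit [FiniteDimensional ℝ E] [CompleteSpace E] [Fact (1 ≤ n)] in
/-- A Ricci-flat (vacuum) Lorentzian metric satisfies the timelike convergence condition.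
Hawking–Ellis 1973, §4.3, p. 95. [cite: HawkingEllis1973, §4.3  p. 95] -/
lemma satisfiesTimelikeConvergence_of_isRicciFlat
    (h : g.toPseudoRiemannianMetric.IsRicciFlat) : g.SatisfiesTimelikeConvergence := by
  intro x v _
  change 0 ≤ g.toPseudoRiemannianMetric.ricci x v v
  simp [h x]

omit [FiniteDimensional ℝ E] [CompleteSpace E] [Fact (1 ≤ n)] in
/-- A Ricci-flat Lorentzian metric satisfies the null convergence condition.
Hawking–Ellis 1973, §4.3, p. 95. [cite: HawkingEllis1973, §4.3  p. 95] -/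
lemma satisfiesNullConvergence_of_isRicciFlat
    (h : g.toPseudoRiemannianMetric.IsRicciFlat) : g.SatisfiesNullConvergence := by
  intro x v _
  change 0 ≤ g.toPseudoRiemannianMetric.ricci x v v
  simp [h x]

end LorentzianMetric

end Literature.Geometry.Lorentzian

end
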